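import Literature.MathematicalPhysics.QuantumLattice.FreeFermionSectorGroundStates
import Literature.MathematicalPhysics.QuantumLattice.TorusBandEdgeCounting
import HarnessLib

/-!
# Spans of orthonormal eigenvectors, orthogonality of paired seas, and column trigonometry of the band

Topic `MathematicalPhysics/QuantumLattice` (family `hubbard`); proof-only toolbox for the `U = 0`
calibration of the level-count clause (H3) of route `HubbardSuperconductivity/ParityGapRigidity`
(`FreeFermionFlatColumn.lean`, `FreeFermionLowLyingLevels.lean`).

* `linearIndependent_of_dotProduct_orthonormal`, `span_orthonormal_eigenvectors` — an orthonormal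
  (`dotProduct`) family of eigenvectors of a matrix `H` with eigenvalues `≤ E_max` spans a subspace of
  dimension the size of the family on which `Re ⟨φ, Hφ⟩ ≤ E_max ⟨φ, φ⟩` (the min–max direction used
  to VIOLATE a level-count bound);
* `star_pairedState_dotProduct_pairedState_eq_zero` — paired seas `Π_{k∈l} b†_k|0⟩` over momentum
  lists `l, l'` with some `q ∈ l ∖ l'` are orthogonal (`n_{q↑}` separates them);
* `exists_cos_step_lt_le` — on an even torus one lattice step away from the zone corner lowers a
  cosine strictly and by at most `2π/L`; `torusBand_vec2` — `ε_L(a, j) = -2cos(2πa/L) - 2cos(2πj/L)`;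
  `cos_sub_cos_le_mul` — `cos u - cos v ≤ (u+v)(v-u)/2` on `0 ≤ u ≤ v ≤ π`;
  `mul_sq_le_one_sub_cos` — `1 - cos v ≥ 2v²/π²` on `[0, π]` (Jordan).

Everything is proved; no definitions, no named facts.  Folklore (linear algebra: Courant–Fischer
direction; trigonometry: Jordan's inequality). [folklore]

## Mathlib / tree search

Mathlib: `linearIndependent_iff'`, `finrank_span_eq_card`, `Submodule.mem_span_range_iff_exists_fun`,
`Real.cos_sub_cos`, `Real.sin_le`, `Real.mul_le_sin`, `Real.cos_lt_cos_of_nonneg_of_le_pi`,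
`Real.cos_two_pi_sub`, `Real.abs_cos_sub_cos_le`.  Tree (REUSED): `momentumNumber_up_pairedState_of_mem`,
`momentumNumber_up_pairedState_of_not_mem`, `momentumNumber_conjTranspose`,
`one_sub_cos_eq_two_mul_sin_sq_half`, `torusBand`, `latticeMomentum`.
-/

noncomputable section

namespace Literature.MathematicalPhysics.QuantumLattice

open Matrix Finset Literature.Probability.LatticeModels
open scoped ComplexOrder ComplexConjugate

/-! ### Generic: the span of an orthonormal family of eigenvectors -/

section Span

variable {m : Type*} [Fintype m]

/-- **An orthonormal family is linearly independent** (`dotProduct` form: `⟨v_i, v_j⟩ = δ_{ij}`).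
[folklore] -/
theorem linearIndependent_of_dotProduct_orthonormal {ι : Type*} [DecidableEq ι] (v : ι → (m → ℂ))
    (hon : ∀ i j, star (v i) ⬝ᵥ v j = if i = j then 1 else 0) : LinearIndependent ℂ v := by
  rw [linearIndependent_iff']
  intro s g hg i hi
  have h := congrArg (fun w => star (v i) ⬝ᵥ w) hg
  simp only [dotProduct_sum, dotProduct_smul, hon, smul_eq_mul, dotProduct_zero] at h
  simpa [hi] using h

/-- **The span of an orthonormal family of eigenvectors with eigenvalues `≤ E_max`** has dimension the
size of the family, and EVERY vector in it has Rayleigh quotient `≤ E_max` (`dotProduct` form).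
[folklore] -/
theorem span_orthonormal_eigenvectors {N : ℕ} (v : Fin N → (m → ℂ))
    (hon : ∀ i j, star (v i) ⬝ᵥ v j = if i = j then 1 else 0)
    (H : Matrix m m ℂ) (E : Fin N → ℝ) (hH : ∀ i, H *ᵥ v i = ((E i : ℝ) : ℂ) • v i) (Emax : ℝ)
    (hE : ∀ i, E i ≤ Emax) :
    (∀ φ ∈ Submodule.span ℂ (Set.range v), (star φ ⬝ᵥ (H *ᵥ φ)).re ≤ Emax * (star φ ⬝ᵥ φ).re) ∧
      Module.finrank ℂ (Submodule.span ℂ (Set.range v)) = N := by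
  classical
  refine ⟨fun φ hφ => ?_, ?_⟩
  · obtain ⟨c, rfl⟩ := (Submodule.mem_span_range_iff_exists_fun ℂ).1 hφ
    -- `⟨φ, Hφ⟩ = Σ |c_i|² E_i`, `⟨φ, φ⟩ = Σ |c_i|²`
    have hstar : star (∑ i, c i • v i) = ∑ i, star (c i) • star (v i) := by
      rw [star_sum]
      exact Finset.sum_congr rfl fun i _ => star_smul _ _
    have hHφ : H *ᵥ (∑ j, c j • v j) = ∑ j, (c j * ((E j : ℝ) : ℂ)) • v j := by
      rw [Matrix.mulVec_sum]
      refine Finset.sum_congr rfl fun j _ => ?_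
      rw [Matrix.mulVec_smul, hH, smul_smul]
    have hpair : ∀ (a b : Fin N → ℂ),
        (∑ i, star (c i) • star (v i)) ⬝ᵥ (∑ j, (a j * b j) • v j) = ∑ i, star (c i) * (a i * b i) := by
      intro a b
      rw [sum_dotProduct]
      refine Finset.sum_congr rfl fun i _ => ?_
      rw [smul_dotProduct, dotProduct_sum]
      simp only [dotProduct_smul, hon, smul_eq_mul, mul_ite, mul_one, mul_zero, Finset.sum_ite_eq,
        Finset.mem_univ, if_true]
    have h1 : (star (∑ i, c i • v i) ⬝ᵥ (H *ᵥ ∑ j, c j • v j)) =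
        ∑ i, star (c i) * (c i * ((E i : ℝ) : ℂ)) := by
      rw [hstar, hHφ, hpair]
    have h2 : (star (∑ i, c i • v i) ⬝ᵥ ∑ j, c j • v j) = ∑ i, star (c i) * c i := by
      have := hpair c (fun _ => 1)
      simp only [mul_one] at this
      rw [hstar]
      exact this
    rw [h1, h2, Complex.re_sum, Complex.re_sum, Finset.mul_sum]
    refine Finset.sum_le_sum fun i _ => ?_
    have hsq : star (c i) * c i = ((‖c i‖ ^ 2 : ℝ) : ℂ) := by
      rw [Complex.star_def, Complex.conj_mul', Complex.ofReal_pow]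
    rw [← mul_assoc, hsq, ← Complex.ofReal_mul, Complex.ofReal_re, Complex.ofReal_re, mul_comm Emax]
    exact mul_le_mul_of_nonneg_left (hE i) (sq_nonneg _)
  · rw [finrank_span_eq_card (linearIndependent_of_dotProduct_orthonormal v hon), Fintype.card_fin]

end Span

/-! ### Paired product states over different momentum sets are orthogonal -/

section Paired

variable {L : ℕ} [NeZero L]

/-- **Paired seas over different momentum sets are orthogonal**: if `q ∈ l` and `q ∉ l'` then
`⟨Φ_{l'}, Φ_l⟩ = 0` (`n_{q↑}` is `1` on `Φ_l`, `0` on `Φ_{l'}`, and Hermitian). [folklore] -/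
theorem star_pairedState_dotProduct_pairedState_eq_zero {l l' : List (TorusSite 2 L)} {q : TorusSite 2 L}
    (hq : q ∈ l) (hq' : q ∉ l') :
    star ((List.map (fun k : TorusSite 2 L => (pairMode k)ᴴ) l').prod *ᵥ (vacuum : Fock (Orb (FermionTorus 2 L)))) ⬝ᵥ
      ((List.map (fun k : TorusSite 2 L => (pairMode k)ᴴ) l).prod *ᵥ (vacuum : Fock (Orb (FermionTorus 2 L)))) = 0 := by
  have haux : ∀ (A : Matrix (Finset (Orb (FermionTorus 2 L))) (Finset (Orb (FermionTorus 2 L))) ℂ)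
      (x y : Fock (Orb (FermionTorus 2 L))), star x ⬝ᵥ (Aᴴ *ᵥ y) = star (A *ᵥ x) ⬝ᵥ y := by
    intro A x y
    rw [star_mulVec, dotProduct_mulVec]
  rw [← momentumNumber_up_pairedState_of_mem hq, ← momentumNumber_conjTranspose q 0, haux,
    momentumNumber_up_pairedState_of_not_mem hq', star_zero, zero_dotProduct]

end Paired

/-! ### Trigonometry of the square-lattice band along a column -/

section Column

variable {L : ℕ} [NeZero L]

/-- **One lattice step changes a cosine by at most `2π/L`, strictly, away from the zone corner** (even
`L`): for a residue `x` with `cos(2πx/L) ≠ -1` there is `x'` with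
`cos(2πx'/L) < cos(2πx/L) ≤ cos(2πx'/L) + 2π/L`. [folklore] -/
theorem exists_cos_step_lt_le (hLe : Even L) (x : ZMod L)
    (hx : Real.cos (2 * Real.pi * (x.val : ℝ) / L) ≠ -1) :
    ∃ x' : ZMod L, Real.cos (2 * Real.pi * (x'.val : ℝ) / L) < Real.cos (2 * Real.pi * (x.val : ℝ) / L) ∧
      Real.cos (2 * Real.pi * (x.val : ℝ) / L) - Real.cos (2 * Real.pi * (x'.val : ℝ) / L) ≤
        2 * Real.pi / L := by
  have hL0 : L ≠ 0 := NeZero.ne L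
  have hL2 : 2 ≤ L := by obtain ⟨m, hm⟩ := hLe; omega
  have hLr : (0 : ℝ) < L := by exact_mod_cast (show 0 < L by omega)
  set v : ℕ := x.val with hv
  have hvL : v < L := ZMod.val_lt x
  have h2v : 2 * v ≠ L := by
    intro h2
    apply hx
    have : 2 * Real.pi * ((v : ℕ) : ℝ) / L = Real.pi := by
      have hLv : (L : ℝ) = 2 * (v : ℝ) := by exact_mod_cast h2.symm
      rw [hLv]
      have hv0 : (v : ℝ) ≠ 0 := by
        intro hv0
        have : v = 0 := by exact_mod_cast hv0
        omega
      field_simp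
    rw [this, Real.cos_pi]
  set v' : ℕ := if 2 * v < L then v + 1 else v - 1 with hv'
  have hv'L : v' < L := by
    rw [hv']; split_ifs <;> omega
  have hval : (((v' : ℕ) : ZMod L)).val = v' := by
    rw [ZMod.val_natCast, Nat.mod_eq_of_lt hv'L]
  set θ : ℝ := 2 * Real.pi * (v : ℝ) / L with hθ
  set θ' : ℝ := 2 * Real.pi * (v' : ℝ) / L with hθ'
  have hstrict : Real.cos θ' < Real.cos θ := by
    by_cases hlt : 2 * v < L
    · have hv'e : v' = v + 1 := by rw [hv', if_pos hlt]
      have h2 : 2 * (v + 1) ≤ L := by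
        obtain ⟨m, hm⟩ := hLe; omega
      have hθ0 : 0 ≤ θ := by rw [hθ]; positivity
      have hθ'π : θ' ≤ Real.pi := by
        rw [hθ', hv'e, div_le_iff₀ hLr]
        have : (2 * ((v + 1 : ℕ) : ℝ)) ≤ L := by exact_mod_cast h2
        push_cast at this ⊢
        nlinarith [Real.pi_pos]
      have hθθ' : θ < θ' := by
        rw [hθ, hθ', hv'e]
        push_cast
        rw [div_lt_div_iff_of_pos_right hLr]
        nlinarith [Real.pi_pos]
      exact Real.cos_lt_cos_of_nonneg_of_le_pi hθ0 hθ'π hθθ'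
    · have hge : L + 2 ≤ 2 * v := by
        obtain ⟨m, hm⟩ := hLe; omega
      have hv'e : v' = v - 1 := by rw [hv', if_neg hlt]
      have hv1 : 1 ≤ v := by omega
      have hx0 : 0 ≤ 2 * Real.pi - θ := by
        rw [hθ, sub_nonneg, div_le_iff₀ hLr]
        have : ((v : ℕ) : ℝ) ≤ L := by exact_mod_cast hvL.le
        nlinarith [Real.pi_pos]
      have hyπ : 2 * Real.pi - θ' ≤ Real.pi := by
        rw [hθ', hv'e]
        have h2 : (L : ℝ) ≤ 2 * ((v - 1 : ℕ) : ℝ) := by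
          have : L ≤ 2 * (v - 1) := by omega
          exact_mod_cast this
        have : Real.pi ≤ 2 * Real.pi * ((v - 1 : ℕ) : ℝ) / L := by
          rw [le_div_iff₀ hLr]
          nlinarith [Real.pi_pos]
        linarith
      have hxy : 2 * Real.pi - θ < 2 * Real.pi - θ' := by
        rw [hθ, hθ', hv'e]
        have : ((v - 1 : ℕ) : ℝ) < (v : ℝ) := by
          rw [Nat.cast_sub hv1]; simp
        have h1 : 2 * Real.pi * ((v - 1 : ℕ) : ℝ) / L < 2 * Real.pi * (v : ℝ) / L := by
          rw [div_lt_div_iff_of_pos_right hLr]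
          nlinarith [Real.pi_pos]
        linarith
      have h := Real.cos_lt_cos_of_nonneg_of_le_pi hx0 hyπ hxy
      rwa [Real.cos_two_pi_sub, Real.cos_two_pi_sub] at h
  have hlip : Real.cos θ - Real.cos θ' ≤ 2 * Real.pi / L := by
    have h := Real.abs_cos_sub_cos_le θ θ'
    have hθd : |θ - θ'| = 2 * Real.pi / L := by
      rw [hθ, hθ']
      have : |(v : ℝ) - (v' : ℝ)| = 1 := by
        rw [hv']
        split_ifs with hlt
        · push_cast; rw [abs_of_nonpos (by linarith)]; ring
        · have hv1 : 1 ≤ v := by omega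
          rw [Nat.cast_sub hv1]; push_cast; rw [abs_of_nonneg (by linarith)]; ring
      rw [show 2 * Real.pi * (v : ℝ) / L - 2 * Real.pi * (v' : ℝ) / L =
        (2 * Real.pi / L) * ((v : ℝ) - (v' : ℝ)) by ring, abs_mul, this, mul_one,
        abs_of_pos (by positivity)]
    rw [hθd] at h
    exact (le_abs_self _).trans h
  refine ⟨(v' : ZMod L), ?_, ?_⟩
  · rw [hval]; exact hstrict
  · rw [hval]; exact hlip

omit [NeZero L] in
/-- The band at the column point `(a, j)`: `ε_L(a, j) = -2cos(2πa/L) - 2cos(2πj/L)`. [folklore] -/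
theorem torusBand_vec2 (a j : ZMod L) :
    torusBand L ![a, j] = -2 * Real.cos (2 * Real.pi * (a.val : ℝ) / L) -
      2 * Real.cos (2 * Real.pi * (j.val : ℝ) / L) := by
  unfold torusBand
  simp only [Fin.sum_univ_two]
  have h0 : latticeMomentum L ![a, j] 0 = 2 * Real.pi * (a.val : ℝ) / L := rfl
  have h1 : latticeMomentum L ![a, j] 1 = 2 * Real.pi * (j.val : ℝ) / L := rfl
  rw [h0, h1]
  ring

/-- **Cosine differences along a column**: for `0 ≤ u ≤ v ≤ π`,
`cos u - cos v ≤ (u + v)(v - u)/2` (`cos u - cos v = 2 sin((u+v)/2) sin((v-u)/2)` and `sin x ≤ x`).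
[folklore] -/
theorem cos_sub_cos_le_mul {u v : ℝ} (hu : 0 ≤ u) (huv : u ≤ v) (hv : v ≤ Real.pi) :
    Real.cos u - Real.cos v ≤ (u + v) * (v - u) / 2 := by
  rw [Real.cos_sub_cos]
  have h1 : Real.sin ((u + v) / 2) ≤ (u + v) / 2 := Real.sin_le (by linarith)
  have h1' : 0 ≤ Real.sin ((u + v) / 2) :=
    Real.sin_nonneg_of_nonneg_of_le_pi (by linarith) (by linarith)
  have h2 : Real.sin ((v - u) / 2) ≤ (v - u) / 2 := Real.sin_le (by linarith)
  have h2' : 0 ≤ Real.sin ((v - u) / 2) :=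
    Real.sin_nonneg_of_nonneg_of_le_pi (by linarith) (by linarith)
  have h3 : Real.sin ((u - v) / 2) = -Real.sin ((v - u) / 2) := by
    rw [← Real.sin_neg]; ring_nf
  rw [h3]
  nlinarith [mul_le_mul h1 h2 h2' (by linarith)]

/-- **Jordan-type lower bound along a column**: for `0 ≤ v ≤ π`, `1 - cos v ≥ 2v²/π²`
(`1 - cos v = 2 sin²(v/2)`, `sin x ≥ 2x/π` on `[0, π/2]`). [folklore] -/
theorem mul_sq_le_one_sub_cos {v : ℝ} (hv0 : 0 ≤ v) (hvπ : v ≤ Real.pi) :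
    2 * v ^ 2 / Real.pi ^ 2 ≤ 1 - Real.cos v := by
  rw [one_sub_cos_eq_two_mul_sin_sq_half]
  have hj := Real.mul_le_sin (by linarith : 0 ≤ v / 2) (by linarith : v / 2 ≤ Real.pi / 2)
  have hj0 : 0 ≤ 2 / Real.pi * (v / 2) := by positivity
  have hsq := mul_self_le_mul_self hj0 hj
  have hπ := Real.pi_pos
  have : 2 * v ^ 2 / Real.pi ^ 2 = 2 * (2 / Real.pi * (v / 2)) * (2 / Real.pi * (v / 2)) := by
    field_simp
  rw [this]
  nlinarith

end Column

end Literature.MathematicalPhysics.QuantumLattice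

end
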